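import Literature.AlgebraicGeometry.Resolution.AbhyankarRationalUniformization
import Mathlib.Algebra.Order.Group.PiLex
import Mathlib.Algebra.Order.Monoid.Prod
import HarnessLib

/-!
# The toric chart of the lattice of invariant exponents (tame cyclic descent, [CoP1] Lemma 9.4)

Topic: `Literature/AlgebraicGeometry/Resolution`. PROOF side of `CossartPiltant2019ReductionP`
(`ArithmeticalThreefoldsLocal.lean`), ninth brick of its one remaining input (C4) — descent of
local uniformization below the ramification field ([CoP1] Props. 9.3/9.5 with Lemma 9.4). After
the diagonalisation of the tame cyclic action (`σ xⱼ = ζ^{tⱼ} xⱼ`, [CoP1] Prop. 6.2 (2),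
`TameCyclicEigenparameters.lean`) the maximal ideal of the ring of invariants `A = B^σ` is
generated by the INVARIANT MONOMIALS `x^h`, `t·h ≡ 0 (mod ℓ)`
(`TameCyclicMonomialStructure.lean`), i.e. by the monoid `ℕ^d ∩ N` of the lattice
`N = {v ∈ ℤ^d : ℓ ∣ t·v}` of invariant exponents; the proof of [CoP1] Lemma 9.4 then passes to
new elements `yᵢ := ∏ⱼ xⱼ^{vᵢⱼ}` of non-negative value in which the old monomials are monomials
((53): "there exists a basis `(v₁,v₂,v₃)` of `ℤ³` such that … (b) `ℕ³ ⊆ ℕv₁ + ℕv₂ + ℕv₃`,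
(c) `∑ⱼ vᵢⱼ W(xⱼ) ≥ 0`", HAL p. 29) — the chart of the toric resolution of the quotient containing
the centre of the valuation (Fulton, §2.6). This file proves the existence of that chart FOR THE
LATTICE `N` (the invariant ring downstairs), in every dimension `d`, for every `ℓ ≥ 1` and for
values in an ARBITRARY linearly ordered abelian group (any rank, any rational rank):

* `exists_basis_pos_of_injective` — PROVED: Knaf–Kuhlmann 2005, Lemma 4.2
  (`PerronTransforms.lean`) for a finitely generated abelian group mapped INJECTIVELY into a
  linearly ordered group (additive twin of `exists_basis_lt_one_of_injective`).
* `exists_latticeBasis_nonneg_of_nsmul_mem` — PROVED, the combinatorial core: for a subgroup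
  `N ⊆ ℤ^d` containing `ℓℤ^d` and weights `w ∈ Γ^d`, `wⱼ ≥ 0`, there is a `ℤ`-basis `n₁, …, n_d`
  of `N` with `ℕ^d ∩ N ⊆ ∑ ℕ nᵢ` and `nᵢ·w ≥ 0`. Proof: the weight map `v ↦ v·w` need not be
  injective, but `v ↦ (v·w, v) ∈ Γ ×ₗ Lex ℤ^d` is, and `ℓe_k ≥ 0` there; Lemma 4.2 in `N` for
  the elements `ℓe_k` gives a basis of elements positive in the refined order (so `nᵢ·w ≥ 0`)
  with every `ℓe_k` an `ℕ`-combination, and then every `h ∈ ℕ^d ∩ N` is one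
  (`ℓh = ∑ h_k (ℓe_k)` and coordinates are unique).
* `exists_latticeBasis_nonneg_of_dvd` — PROVED: the same for `N = {v : ℓ ∣ ∑ tⱼ vⱼ}`.
* `exists_toricChart_of_addSubgroup` — PROVED: the same chart for an ARBITRARY subgroup
  `N ⊇ ℓℤ^d` of exponents (diagonalisable abelian tame groups, e.g. Kummer coverings).
* `exists_invariant_toricChart` — PROVED, valuation currency of the (C4) files: for non-zero
  `x₁, …, x_d` in a valuation ring `O` of a field and characters `t`, there are exponent vectors
  `n₁, …, n_d ∈ ℤ^d` with `ℓ ∣ t·nᵢ` (the Laurent monomials `yᵢ = x^{nᵢ}` are `σ`-invariant),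
  `yᵢ ∈ O`, every invariant monomial `x^h` (`h ∈ ℕ^d`, `t·h ≡ 0`) a monomial `∏ yᵢ^{cᵢ}`, and
  the `nᵢ` a `ℤ`-basis of the invariant exponents.

What this does NOT give is the source's simultaneous statement (a) "`(ℓv₁, v₂, v₃)` is a basis of
`N`" for a basis `(vᵢ)` of `ℤ³` (a chart that is ALSO regular upstairs, on which `σ` becomes a
pseudo-reflection): its two-variable analogue is false (memo `Sketch-memo-hand1-g7.md` §2 (β) of
the `CleanModels` crux) and the three-variable case is undecided; the toric route through the
present chart does not need it.

Everything is PROVED; no named facts are introduced.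

## Sources

* V. Cossart, O. Piltant, *Resolution of singularities of threefolds in positive characteristic.
  I*, J. Algebra 320 (2008) 1051–1082: proof of Lemma 9.4, (53)–(54) (HAL hal-00139124, p. 29).
  [CossartPiltant2008]
* W. Fulton, *Introduction to Toric Varieties*, Ann. of Math. Studies 131 (1993): §2.6
  (pp. 45–50), refinement of a simplicial cone to nonsingular cones. [Fulton1993Toric]
* H. Knaf, F.-V. Kuhlmann, *Abhyankar places admit local uniformization in any characteristic*,
  Ann. Sci. ÉNS 38 (2005) 833–846: Lemma 4.2. [KnafKuhlmann2005]
-/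

noncomputable section

namespace Literature.AlgebraicGeometry.Resolution

open Module

section Injective

/-- **Knaf–Kuhlmann 2005, Lemma 4.2, for a lattice mapped injectively into an ordered group**
(additive twin of `exists_basis_lt_one_of_injective`, `PerronTransforms.lean`): for a finitely
generated abelian group `V`, an INJECTIVE homomorphism `φ` from `V` to a linearly ordered abelian
group and finitely many `d ∈ V` with `φ d ≥ 0`, there is a `ℤ`-basis `e` of `V` with all
`φ (e i) > 0` in which every `d` has non-negative coordinates. PROVED
(`exists_basis_pos_forall_repr_nonneg` for the order on `V` pulled back from `φ`).
[cite: KnafKuhlmann2005, Lemma 4.2] -/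
theorem exists_basis_pos_of_injective {V : Type*} [AddCommGroup V] [Module.Finite ℤ V]
    {Γ : Type*} [AddCommGroup Γ] [LinearOrder Γ] [IsOrderedAddMonoid Γ]
    (φ : V →+ Γ) (hφ : Function.Injective φ) (D : Finset V) (hD : ∀ d ∈ D, 0 ≤ φ d) :
    ∃ e : Module.Basis (Fin (Module.finrank ℤ V)) ℤ V,
      (∀ i, 0 < φ (e i)) ∧ ∀ d ∈ D, ∀ i, 0 ≤ e.repr d i := by
  letI : LinearOrder V := LinearOrder.lift' φ hφ
  have hle : ∀ v w : V, v ≤ w ↔ φ v ≤ φ w := fun v w => Iff.rfl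
  have hlt : ∀ v w : V, v < w ↔ φ v < φ w := fun v w => by
    rw [lt_iff_le_not_ge, hle, hle, lt_iff_le_not_ge]
  haveI : IsOrderedAddMonoid V :=
    { add_le_add_left := fun v w hvw u => by
        rw [hle] at hvw ⊢
        simpa only [map_add, add_comm] using add_le_add_left hvw (φ u) }
  obtain ⟨e, he, hD'⟩ := exists_basis_pos_forall_repr_nonneg (Γ := V) D fun d hd => by
    rw [hle, map_zero]
    exact hD d hd
  refine ⟨e, fun i => ?_, hD'⟩
  have h := he i
  rwa [hlt, map_zero] at h

end Injective

section Lattice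

variable {Γ : Type*} [AddCommGroup Γ] [LinearOrder Γ] [IsOrderedAddMonoid Γ]

/-- **The chart of the toric resolution containing the centre, for a sublattice of finite
index** ([CoP1] proof of Lemma 9.4, (53): a basis with (b) `ℕ³ ⊆ ∑ ℕvᵢ` and
(c) `∑ⱼ vᵢⱼ W(xⱼ) ≥ 0`; Fulton §2.6: refining the positive orthant, simplicial of multiplicity
`[ℤ^d : N]` for the lattice `N`, to nonsingular cones and taking the one containing `w`). For a
subgroup `N ⊆ ℤ^d` with `ℓℤ^d ⊆ N` (`ℓ ≥ 1`) and weights `wⱼ ≥ 0` in a linearly ordered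
abelian group there are `n₁, …, n_d ∈ N` such that: every `h ∈ N` is uniquely `∑ cᵢ nᵢ`
(`cᵢ ∈ ℤ`) — a `ℤ`-basis —, every `h ∈ N` with `h ≥ 0` coordinatewise has these `cᵢ ∈ ℕ`
("`ℕ^d ∩ N ⊆ ∑ ℕ nᵢ`"), and `∑ⱼ nᵢⱼ wⱼ ≥ 0` for every `i`. PROVED (Knaf–Kuhlmann's Lemma 4.2
in `N` for the injective refinement `v ↦ (v·w, v) ∈ Γ ×ₗ Lex ℤ^d` and the elements `ℓ e_k`).
[cite: CossartPiltant2008, proof of Lemma 9.4, (53) (HAL p. 29)]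
[cite: Fulton1993Toric, Section 2.6 (pp. 45–50)] -/
theorem exists_latticeBasis_nonneg_of_nsmul_mem {d : ℕ} (N : AddSubgroup (Fin d → ℤ)) {ℓ : ℕ}
    (hℓ : 0 < ℓ) (hN : ∀ v : Fin d → ℤ, ℓ • v ∈ N) (w : Fin d → Γ) (hw : ∀ j, 0 ≤ w j) :
    ∃ n : Fin d → (Fin d → ℤ),
      (∀ i, n i ∈ N) ∧
      (∀ h ∈ N, ∃! c : Fin d → ℤ, h = ∑ i, c i • n i) ∧
      (∀ h ∈ N, (∀ j, 0 ≤ h j) → ∃ c : Fin d → ℕ, h = ∑ i, c i • n i) ∧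
      (∀ i, 0 ≤ ∑ j, n i j • w j) := by
  classical
  -- the lattice as a `ℤ`-submodule; it is finitely generated
  let P : Submodule ℤ (Fin d → ℤ) := AddSubgroup.toIntSubmodule N
  have hPN : ∀ v, v ∈ P ↔ v ∈ N := fun v => Iff.rfl
  haveI : Module.Finite ℤ P :=
    Module.Finite.of_injective P.subtype P.injective_subtype
  -- the weight map `φ v = v·w`
  let φ : (Fin d → ℤ) →+ Γ :=
    { toFun := fun v => ∑ j, v j • w j
      map_zero' := by simp
      map_add' := fun u v => by
        simp only [Pi.add_apply, add_zsmul, Finset.sum_add_distrib] }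
  have hφ : ∀ v : Fin d → ℤ, φ v = ∑ j, v j • w j := fun v => rfl
  -- the injective refinement `ψ v = (φ v, v) ∈ Γ ×ₗ Lex ℤ^d`
  let ψ : P →+ Γ ×ₗ Lex (Fin d → ℤ) :=
    { toFun := fun v => toLex (φ v, toLex (v : Fin d → ℤ))
      map_zero' := by
        simp only [ZeroMemClass.coe_zero, map_zero, toLex_zero, Prod.mk_zero_zero]
      map_add' := fun u v => by
        rw [← toLex_add, Prod.mk_add_mk, ← toLex_add, ← map_add, Submodule.coe_add] }
  have hψ_apply : ∀ v : P, ψ v = toLex (φ v, toLex (v : Fin d → ℤ)) := fun v => rfl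
  have hψ : Function.Injective ψ := by
    intro u v huv
    rw [hψ_apply, hψ_apply, toLex_inj, Prod.mk.injEq, toLex_inj] at huv
    exact Subtype.ext huv.2
  have h0 : (0 : Γ ×ₗ Lex (Fin d → ℤ)) = toLex ((0 : Γ), toLex (0 : Fin d → ℤ)) := rfl
  -- the elements `ℓ e_k ∈ N`
  have hsingle : ∀ k : Fin d, (Pi.single k (ℓ : ℤ) : Fin d → ℤ) = ℓ • Pi.single k (1 : ℤ) := by
    intro k
    ext j
    by_cases hjk : j = k
    · subst hjk; simp
    · simp [Pi.single_eq_of_ne hjk]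
  have hbmem : ∀ k : Fin d, (Pi.single k (ℓ : ℤ) : Fin d → ℤ) ∈ P := fun k => by
    rw [hPN, hsingle]; exact hN _
  let b : Fin d → P := fun k => ⟨Pi.single k (ℓ : ℤ), hbmem k⟩
  have hφb : ∀ k, φ (b k : Fin d → ℤ) = (ℓ : ℤ) • w k := fun k => by
    rw [hφ]
    change (∑ j, (Pi.single k (ℓ : ℤ) : Fin d → ℤ) j • w j) = (ℓ : ℤ) • w k
    rw [Finset.sum_eq_single k (fun j _ hjk => by rw [Pi.single_eq_of_ne hjk, zero_zsmul])
      (fun h => absurd (Finset.mem_univ k) h), Pi.single_eq_same]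
  let D : Finset P := Finset.univ.image b
  have hD : ∀ x ∈ D, 0 ≤ ψ x := by
    intro x hx
    obtain ⟨k, -, rfl⟩ := Finset.mem_image.mp hx
    rw [h0, hψ_apply, Prod.Lex.toLex_le_toLex, hφb]
    have hnn : 0 ≤ (ℓ : ℤ) • w k := zsmul_nonneg (hw k) (by exact_mod_cast hℓ.le)
    rcases hnn.lt_or_eq with hlt | heq
    · exact Or.inl hlt
    · refine Or.inr ⟨heq, Pi.toLex_monotone fun j => ?_⟩
      change (0 : ℤ) ≤ (Pi.single k (ℓ : ℤ) : Fin d → ℤ) j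
      by_cases hjk : j = k
      · subst hjk; simp
      · simp [Pi.single_eq_of_ne hjk]
  -- Knaf–Kuhlmann's Lemma 4.2 in `P` for the refined order
  obtain ⟨e, he, heD⟩ := exists_basis_pos_of_injective ψ hψ D hD
  -- `rank P = d`
  have hr : Module.finrank ℤ P = d := by
    apply le_antisymm
    · calc Module.finrank ℤ P ≤ Module.finrank ℤ (Fin d → ℤ) := Submodule.finrank_le P
        _ = d := Module.finrank_fin_fun ℤ
    · let f : (Fin d → ℤ) →ₗ[ℤ] (Fin d → ℤ) := (ℓ : ℤ) • LinearMap.id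
      have hf : Function.Injective f := fun u v huv => by
        have hℓ0 : (ℓ : ℤ) ≠ 0 := by exact_mod_cast hℓ.ne'
        exact smul_right_injective (Fin d → ℤ) hℓ0 huv
      have hfP : LinearMap.range f ≤ P := by
        rintro _ ⟨v, rfl⟩
        change (ℓ : ℤ) • v ∈ P
        rw [hPN, natCast_zsmul]
        exact hN v
      calc d = Module.finrank ℤ (Fin d → ℤ) := (Module.finrank_fin_fun ℤ).symm
        _ = Module.finrank ℤ (LinearMap.range f) := (LinearMap.finrank_range_of_inj hf).symm
        _ ≤ Module.finrank ℤ P := Submodule.finrank_mono hfP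
  -- reindex by `Fin d`
  let τ : Fin (Module.finrank ℤ P) ≃ Fin d := finCongr hr
  let e' : Module.Basis (Fin d) ℤ P := e.reindex τ
  have he' : ∀ i, e' i = e (τ.symm i) := fun i => Module.Basis.reindex_apply _ _ _
  have he'repr : ∀ (x : P) (i : Fin d), e'.repr x i = e.repr x (τ.symm i) := fun x i =>
    Module.Basis.repr_reindex_apply _ _ _ _
  let n : Fin d → (Fin d → ℤ) := fun i => (e' i : Fin d → ℤ)
  have hn : ∀ i, n i = (e' i : Fin d → ℤ) := fun i => rfl
  -- coordinates: `h = ∑ (e'.repr h)ᵢ nᵢ`, uniquely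
  have hcoe_sum : ∀ c : Fin d → ℤ, ((∑ i, c i • e' i : P) : Fin d → ℤ) = ∑ i, c i • n i :=
    fun c => by
    rw [AddSubmonoidClass.coe_finsetSum]
    exact Finset.sum_congr rfl fun i _ => by rw [Submodule.coe_smul, hn]
  have hrepr : ∀ x : P, (x : Fin d → ℤ) = ∑ i, e'.repr x i • n i := fun x => by
    rw [← hcoe_sum]
    exact congrArg Subtype.val (e'.sum_repr x).symm
  have huniq : ∀ (x : P) (c : Fin d → ℤ), (x : Fin d → ℤ) = ∑ i, c i • n i →
      c = ⇑(e'.repr x) := fun x c hc => by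
    have hx : x = ∑ i, c i • e' i := Subtype.ext (by rw [hcoe_sum]; exact hc)
    have h := e'.repr_sum_self c
    rw [← hx] at h
    exact h.symm
  -- non-negative coordinates of the `ℓ e_k`, hence of every `h ≥ 0`
  have hbnn : ∀ k i, 0 ≤ e'.repr (b k) i := fun k i => by
    rw [he'repr]
    exact heD (b k) (Finset.mem_image.mpr ⟨k, Finset.mem_univ k, rfl⟩) _
  have hnnrepr : ∀ x : P, (∀ j, 0 ≤ (x : Fin d → ℤ) j) → ∀ i, 0 ≤ e'.repr x i := by
    intro x hx i
    have hℓx : ((ℓ : ℤ) • x : P) = ∑ k, (x : Fin d → ℤ) k • b k := by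
      apply Subtype.ext
      rw [Submodule.coe_smul, AddSubmonoidClass.coe_finsetSum]
      ext j
      simp only [Pi.smul_apply, smul_eq_mul, Finset.sum_apply, Submodule.coe_smul, b,
        Pi.single_apply, mul_ite, mul_zero, Finset.sum_ite_eq, Finset.mem_univ, if_true]
      ring
    have hcoord : (ℓ : ℤ) * e'.repr x i = ∑ k, (x : Fin d → ℤ) k * e'.repr (b k) i := by
      have h1 := congrArg (fun y : P => e'.repr y i) hℓx
      simp only [map_smul, map_sum, Finsupp.coe_smul, Finsupp.coe_finsetSum, Pi.smul_apply,
        Finset.sum_apply, smul_eq_mul] at h1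
      exact h1
    have hsum : 0 ≤ ∑ k, (x : Fin d → ℤ) k * e'.repr (b k) i :=
      Finset.sum_nonneg fun k _ => mul_nonneg (hx k) (hbnn k i)
    rw [← hcoord] at hsum
    by_contra hneg
    push Not at hneg
    have : (ℓ : ℤ) * e'.repr x i < 0 := mul_neg_of_pos_of_neg (by exact_mod_cast hℓ) hneg
    exact absurd hsum (not_le.mpr this)
  refine ⟨n, fun i => (e' i).2, fun h hh => ?_, fun h hh hh0 => ?_, fun i => ?_⟩
  · -- unique integer coordinates
    refine ⟨⇑(e'.repr ⟨h, hh⟩), hrepr ⟨h, hh⟩, fun c hc => huniq ⟨h, hh⟩ c hc⟩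
  · -- natural coordinates for `h ≥ 0`
    refine ⟨fun i => (e'.repr ⟨h, hh⟩ i).toNat, ?_⟩
    conv_lhs => rw [show h = ((⟨h, hh⟩ : P) : Fin d → ℤ) from rfl, hrepr ⟨h, hh⟩]
    refine Finset.sum_congr rfl fun i _ => ?_
    rw [← natCast_zsmul, Int.toNat_of_nonneg (hnnrepr ⟨h, hh⟩ hh0 i)]
  · -- `nᵢ·w ≥ 0`: `ψ (e' i) > 0` in the refined order
    have hpos : 0 < ψ (e' i) := by rw [he']; exact he _
    rw [h0, hψ_apply, Prod.Lex.toLex_lt_toLex] at hpos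
    rw [← hφ]
    rcases hpos with hlt | ⟨heq, -⟩
    · exact hlt.le
    · exact heq.le

/-- **The toric chart for the lattice of invariant exponents `N = {v ∈ ℤ^d : ℓ ∣ t·v}`** of a
diagonal action `xⱼ ↦ ζ^{tⱼ} xⱼ` of a cyclic group of order `ℓ` ([CoP1] proof of Lemma 9.4,
(53)–(54); Fulton §2.6 for the cyclic quotient singularity): a `ℤ`-basis `n₁, …, n_d` of `N`
(unique integer coordinates) such that every `h ∈ N` with `h ≥ 0` is an `ℕ`-combination of the
`nᵢ` and `∑ⱼ nᵢⱼ wⱼ ≥ 0` for given weights `wⱼ ≥ 0` in any linearly ordered abelian group.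
PROVED (`exists_latticeBasis_nonneg_of_nsmul_mem`).
[cite: CossartPiltant2008, proof of Lemma 9.4, (53)–(54) (HAL p. 29)]
[cite: Fulton1993Toric, Section 2.6 (pp. 45–50)] -/
theorem exists_latticeBasis_nonneg_of_dvd {d ℓ : ℕ} (hℓ : 0 < ℓ) (t : Fin d → ℤ)
    (w : Fin d → Γ) (hw : ∀ j, 0 ≤ w j) :
    ∃ n : Fin d → (Fin d → ℤ),
      (∀ i, (ℓ : ℤ) ∣ ∑ j, t j * n i j) ∧
      (∀ h : Fin d → ℤ, (ℓ : ℤ) ∣ ∑ j, t j * h j → ∃! c : Fin d → ℤ, h = ∑ i, c i • n i) ∧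
      (∀ h : Fin d → ℤ, (ℓ : ℤ) ∣ ∑ j, t j * h j → (∀ j, 0 ≤ h j) →
        ∃ c : Fin d → ℕ, h = ∑ i, c i • n i) ∧
      (∀ i, 0 ≤ ∑ j, n i j • w j) := by
  -- the subgroup of invariant exponents
  let N : AddSubgroup (Fin d → ℤ) :=
    { carrier := {v | (ℓ : ℤ) ∣ ∑ j, t j * v j}
      add_mem' := fun {u v} hu hv => by
        simp only [Set.mem_setOf_eq, Pi.add_apply, mul_add, Finset.sum_add_distrib] at hu hv ⊢
        exact dvd_add hu hv
      zero_mem' := by simp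
      neg_mem' := fun {v} hv => by
        simp only [Set.mem_setOf_eq, Pi.neg_apply, mul_neg, Finset.sum_neg_distrib] at hv ⊢
        exact (dvd_neg).mpr hv }
  have hmem : ∀ v : Fin d → ℤ, v ∈ N ↔ (ℓ : ℤ) ∣ ∑ j, t j * v j := fun v => Iff.rfl
  have hN : ∀ v : Fin d → ℤ, ℓ • v ∈ N := fun v => by
    rw [hmem]
    refine ⟨∑ j, t j * v j, ?_⟩
    rw [Finset.mul_sum]
    exact Finset.sum_congr rfl fun j _ => by
      rw [Pi.smul_apply, nsmul_eq_mul]; ring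
  obtain ⟨n, hnN, huniq, hnat, hwn⟩ := exists_latticeBasis_nonneg_of_nsmul_mem N hℓ hN w hw
  exact ⟨n, fun i => (hmem _).mp (hnN i), fun h hh => huniq h ((hmem h).mpr hh),
    fun h hh hh0 => hnat h ((hmem h).mpr hh) hh0, hwn⟩

end Lattice

section Valuation

universe u

variable {E : Type u} [Field E] (O : ValuationSubring E)

/-- **The invariant toric chart in valuation currency** ([CoP1] proof of Lemma 9.4, (53)–(54):
"`yᵢ := ∏ⱼ xⱼ^{vᵢⱼ}` … By (c), `S₁ := S̄_{𝔪_W ∩ S̄}` is a local model of `W`", HAL p. 29; here for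
the ring of INVARIANTS of the diagonal action `xⱼ ↦ ζ^{tⱼ} xⱼ`, whose maximal ideal is generated
by the invariant monomials, `TameCyclicMonomialStructure.lean`). For non-zero `x₁, …, x_d` in a
valuation ring `O` of a field, `ℓ ≥ 1` and characters `t`, there are exponent vectors
`n₁, …, n_d ∈ ℤ^d` such that: `ℓ ∣ t·nᵢ` (the Laurent monomials `yᵢ = ∏ⱼ xⱼ^{nᵢⱼ}` are
invariant), `yᵢ ∈ O`, every invariant monomial `x^h` (`h ∈ ℕ^d`, `t·h ≡ 0 (mod ℓ)`) is a
monomial `∏ᵢ yᵢ^{cᵢ}` with `cᵢ ∈ ℕ`, and the `nᵢ` are a `ℤ`-basis of the invariant exponents.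
PROVED (`exists_latticeBasis_nonneg_of_dvd` for the weights `-v(xⱼ)` in `Additive |E^×|`).
[cite: CossartPiltant2008, proof of Lemma 9.4, (53)–(54) (HAL p. 29)]
[cite: Fulton1993Toric, Section 2.6 (pp. 45–50)] -/
theorem exists_invariant_toricChart {d ℓ : ℕ} (hℓ : 0 < ℓ) (t : Fin d → ℕ) (x : Fin d → E)
    (hx0 : ∀ j, x j ≠ 0) (hxO : ∀ j, x j ∈ O) :
    ∃ n : Fin d → (Fin d → ℤ),
      (∀ i, (ℓ : ℤ) ∣ ∑ j, (t j : ℤ) * n i j) ∧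
      (∀ i, (∏ j, x j ^ n i j) ∈ O) ∧
      (∀ h : Fin d → ℕ, (∑ j, t j * h j) % ℓ = 0 →
        ∃ c : Fin d → ℕ, (∏ j, x j ^ h j) = ∏ i, (∏ j, x j ^ n i j) ^ c i) ∧
      (∀ h : Fin d → ℤ, (ℓ : ℤ) ∣ ∑ j, (t j : ℤ) * h j →
        ∃! c : Fin d → ℤ, h = ∑ i, c i • n i) := by
  classical
  -- the values as units, and the weights `wⱼ = -v(xⱼ)` in the additive value group
  let u : Fin d → (ValuationSubring.ValueGroup O)ˣ := fun j =>
    Units.mk0 (O.valuation (x j)) ((Valuation.ne_zero_iff _).mpr (hx0 j))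
  have hu : ∀ j, ((u j : (ValuationSubring.ValueGroup O)ˣ) : ValuationSubring.ValueGroup O) =
      O.valuation (x j) := fun j => Units.val_mk0 _
  let w : Fin d → Additive (ValuationSubring.ValueGroup O)ˣ := fun j => -Additive.ofMul (u j)
  have hw : ∀ j, 0 ≤ w j := fun j => by
    change (0 : Additive (ValuationSubring.ValueGroup O)ˣ) ≤ -Additive.ofMul (u j)
    rw [neg_nonneg, ← ofMul_one, Additive.ofMul_le, ← Units.val_le_val, hu, Units.val_one]
    exact (O.valuation_le_one_iff _).mpr (hxO j)
  obtain ⟨n, hdvd, huniq, hnat, hwn⟩ :=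
    exists_latticeBasis_nonneg_of_dvd (Γ := Additive (ValuationSubring.ValueGroup O)ˣ) hℓ
      (fun j => (t j : ℤ)) w hw
  -- the value of a Laurent monomial, through the units
  have hval : ∀ m : Fin d → ℤ, O.valuation (∏ j, x j ^ m j) =
      (((∏ j, u j ^ m j : (ValuationSubring.ValueGroup O)ˣ)) : ValuationSubring.ValueGroup O) :=
    fun m => by
    rw [valuation_prod_zpow]
    simp only [Units.coe_prod, Units.val_zpow_eq_zpow_val, hu]
  have hwsum : ∀ m : Fin d → ℤ, (∑ j, m j • w j) = -Additive.ofMul (∏ j, u j ^ m j) := fun m => by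
    simp only [w, smul_neg, Finset.sum_neg_distrib, ofMul_prod, ofMul_zpow]
  refine ⟨n, hdvd, fun i => ?_, fun h hh => ?_, huniq⟩
  · -- `yᵢ ∈ O`
    rw [← O.valuation_le_one_iff, hval, ← Units.val_one, Units.val_le_val, ← Additive.ofMul_le,
      ofMul_one, ← neg_nonneg, ← hwsum]
    exact hwn i
  · -- invariant monomials are monomials in the `yᵢ`
    have hh' : (ℓ : ℤ) ∣ ∑ j, (t j : ℤ) * ((h j : ℕ) : ℤ) := by
      have h1 : ℓ ∣ ∑ j, t j * h j := Nat.dvd_of_mod_eq_zero hh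
      have h2 := Int.natCast_dvd_natCast.mpr h1
      push_cast at h2
      exact h2
    obtain ⟨c, hc⟩ := hnat (fun j => (h j : ℤ)) hh' fun j => Int.natCast_nonneg _
    refine ⟨c, ?_⟩
    have hc' : (fun j => (h j : ℤ)) = ∑ i, ((c i : ℤ)) • n i := by
      rw [hc]; exact Finset.sum_congr rfl fun i _ => (natCast_zsmul _ _).symm
    calc (∏ j, x j ^ h j) = ∏ j, x j ^ ((fun j => (h j : ℤ)) j) := (prod_zpow_natCast x h).symm
      _ = ∏ j, x j ^ ((∑ i, ((c i : ℤ)) • n i) j) := by rw [hc']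
      _ = ∏ i, ∏ j, x j ^ ((((c i : ℤ)) • n i) j) := prod_zpow_sum x hx0 Finset.univ _
      _ = ∏ i, (∏ j, x j ^ n i j) ^ c i := Finset.prod_congr rfl fun i _ => by
          rw [prod_zpow_zsmul, zpow_natCast]

/-- **The toric chart for an arbitrary lattice of invariant exponents** (the case of a
DIAGONALISABLE ABELIAN tame group `H`, e.g. the Galois group of exponent `ℓ` of a Kummer covering
`A′(ρ₁, …, ρ_n)`: the invariant exponents `N = {v : χ(v) = 0 ∀ χ}` form a subgroup of `ℤ^d`
containing `ℓℤ^d`; [CoP1] proof of Lemma 9.4, (53)–(54), and Fulton §2.6 for the quotient by a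
finite abelian group). For non-zero `x₁, …, x_d` in a valuation ring `O` of a field and a subgroup
`N ⊆ ℤ^d` with `ℓℤ^d ⊆ N` (`ℓ ≥ 1`), there are exponent vectors `n₁, …, n_d ∈ N`, a `ℤ`-basis of
`N`, with `yᵢ := ∏ⱼ xⱼ^{nᵢⱼ} ∈ O` and every monomial `x^h`, `h ∈ ℕ^d ∩ N`, a monomial
`∏ᵢ yᵢ^{cᵢ}` with `cᵢ ∈ ℕ`. PROVED (`exists_latticeBasis_nonneg_of_nsmul_mem` for the weights
`-v(xⱼ)`). [cite: CossartPiltant2008, proof of Lemma 9.4, (53)–(54) (HAL p. 29)]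
[cite: Fulton1993Toric, Section 2.6 (pp. 45–50)] -/
theorem exists_toricChart_of_addSubgroup {d ℓ : ℕ} (hℓ : 0 < ℓ) (N : AddSubgroup (Fin d → ℤ))
    (hN : ∀ v : Fin d → ℤ, ℓ • v ∈ N) (x : Fin d → E) (hx0 : ∀ j, x j ≠ 0) (hxO : ∀ j, x j ∈ O) :
    ∃ n : Fin d → (Fin d → ℤ),
      (∀ i, n i ∈ N) ∧
      (∀ i, (∏ j, x j ^ n i j) ∈ O) ∧
      (∀ h : Fin d → ℕ, (fun j => (h j : ℤ)) ∈ N →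
        ∃ c : Fin d → ℕ, (∏ j, x j ^ h j) = ∏ i, (∏ j, x j ^ n i j) ^ c i) ∧
      (∀ h ∈ N, ∃! c : Fin d → ℤ, h = ∑ i, c i • n i) := by
  classical
  let u : Fin d → (ValuationSubring.ValueGroup O)ˣ := fun j =>
    Units.mk0 (O.valuation (x j)) ((Valuation.ne_zero_iff _).mpr (hx0 j))
  have hu : ∀ j, ((u j : (ValuationSubring.ValueGroup O)ˣ) : ValuationSubring.ValueGroup O) =
      O.valuation (x j) := fun j => Units.val_mk0 _
  let w : Fin d → Additive (ValuationSubring.ValueGroup O)ˣ := fun j => -Additive.ofMul (u j)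
  have hw : ∀ j, 0 ≤ w j := fun j => by
    change (0 : Additive (ValuationSubring.ValueGroup O)ˣ) ≤ -Additive.ofMul (u j)
    rw [neg_nonneg, ← ofMul_one, Additive.ofMul_le, ← Units.val_le_val, hu, Units.val_one]
    exact (O.valuation_le_one_iff _).mpr (hxO j)
  obtain ⟨n, hnN, huniq, hnat, hwn⟩ :=
    exists_latticeBasis_nonneg_of_nsmul_mem (Γ := Additive (ValuationSubring.ValueGroup O)ˣ) N hℓ
      hN w hw
  have hval : ∀ m : Fin d → ℤ, O.valuation (∏ j, x j ^ m j) =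
      (((∏ j, u j ^ m j : (ValuationSubring.ValueGroup O)ˣ)) : ValuationSubring.ValueGroup O) :=
    fun m => by
    rw [valuation_prod_zpow]
    simp only [Units.coe_prod, Units.val_zpow_eq_zpow_val, hu]
  have hwsum : ∀ m : Fin d → ℤ, (∑ j, m j • w j) = -Additive.ofMul (∏ j, u j ^ m j) := fun m => by
    simp only [w, smul_neg, Finset.sum_neg_distrib, ofMul_prod, ofMul_zpow]
  refine ⟨n, hnN, fun i => ?_, fun h hh => ?_, huniq⟩
  · rw [← O.valuation_le_one_iff, hval, ← Units.val_one, Units.val_le_val, ← Additive.ofMul_le,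
      ofMul_one, ← neg_nonneg, ← hwsum]
    exact hwn i
  · obtain ⟨c, hc⟩ := hnat (fun j => (h j : ℤ)) hh fun j => Int.natCast_nonneg _
    refine ⟨c, ?_⟩
    have hc' : (fun j => (h j : ℤ)) = ∑ i, ((c i : ℤ)) • n i := by
      rw [hc]; exact Finset.sum_congr rfl fun i _ => (natCast_zsmul _ _).symm
    calc (∏ j, x j ^ h j) = ∏ j, x j ^ ((fun j => (h j : ℤ)) j) := (prod_zpow_natCast x h).symm
      _ = ∏ j, x j ^ ((∑ i, ((c i : ℤ)) • n i) j) := by rw [hc']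
      _ = ∏ i, ∏ j, x j ^ ((((c i : ℤ)) • n i) j) := prod_zpow_sum x hx0 Finset.univ _
      _ = ∏ i, (∏ j, x j ^ n i j) ^ c i := Finset.prod_congr rfl fun i _ => by
          rw [prod_zpow_zsmul, zpow_natCast]

end Valuation

end Literature.AlgebraicGeometry.Resolution

end
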